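import Literature.NumberTheory.Transcendental.PadicAuxiliaryFunction
import Literature.NumberTheory.Transcendental.LinGroupKComplex
import Literature.NumberTheory.Transcendental.RoyPadicRankThm4OfWaldschmidt
import Literature.NumberTheory.Transcendental.PadicLogAlgClProofs
import Literature.NumberTheory.Transcendental.BrumerPadicAnalytic
import Literature.NumberTheory.Transcendental.LinGroupZEMain
import HarnessLib

/-!
# Roy 1992, Theorem 1 for `K = ℚ̄_p` (M. Waldschmidt's Theorem 4.1, `p`-adic case) from the zero estimate

Topic `Literature/NumberTheory/Transcendental` (namespace `Literature.NumberTheory.Transcendental`,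
grouping sub-namespace `RoyPadic`). Everything here is PROVED; no definitions, no named facts.

This file closes the `p`-adic chain towards the named fact `roy1992_padic_thm4` (Roy 1992, §4
Theorem 4 for `K = ℚ̄_p`): its only transcendence input is Roy's Theorem 1 — "Theorem 4.1 of [W3]
applied to a linear algebraic group `G_a^{d₀} × G_m^{d₁}`" over `K = ℂ_p` ([Roy1992, §1, p. 25];
[Waldschmidt1988, Thm 4.1], printed over `ℂ`) — in the shape `RoyRank.Thm1 (padicQbar p) (logQSpan p) 0`
(`roy1992_padic_thm4_of_waldschmidt`, `RoyPadicRankThm4OfWaldschmidt.lean`). We PROVE that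
statement from Philippon's zero estimate with multiplicities on `𝔾ₐ^{d₀} × 𝔾ₘ^{d₁}`
(`LinGroupK.ZeroEstimate`), the one purely algebraic input of Waldschmidt's proof, taken as an
explicit hypothesis over `ℚ̄_p` (`RoyPadic.thm1_of_zeroEstimate`) — equivalently, by Steinitz
transport `ℂ ≃+* ℚ̄_p` (`LinGroupK.zeroEstimate_padicAlgCl_of_complex`), over `ℂ`
(`RoyPadic.thm1_of_complexZeroEstimate`, `roy1992_padic_thm4_of_complexZeroEstimate`), where it
is the zero-estimate hypothesis `hZE` of the tree's complex assembly
`LinGroup.weakObstruction_of_zeroEstimate_of_auxiliary` (a theorem of the tree for `d₀ = 1`,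
`Philippon1986_GaGm_holds`).

The proof is Waldschmidt's ([Waldschmidt1988, §§6–7]) in the `p`-adic case, entirely formalised
in the companion files: the auxiliary function is `LinGroupK.exists_auxiliary`
(`PadicAuxiliaryFunction.lean`: interpolation-free construction, box principle on Taylor
coefficients, `p`-adic Liouville), the end of the proof is the field-generic §7 assembly
`LinGroupK.weakObstruction_of_zeroEstimate_of_auxiliary` through
`LinGroupK.royObstruction_of_zeroEstimate_of_auxiliary` and
`RoyRank.thm1_zero_of_linearSubgroupTheorem_weak`. The present file supplies the reduction of
Roy's data `(Y, W, V)` (`Y ⊆ ℚ̄^{d₀} × L^{d₁}`, `L = ℚ·log_p(ℚ̄ ∩ U₁)`, `W` rational over `ℚ̄`) to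
the normal form of those files: a small frame of `V` with coefficients in a `ℚ_p`-finite field
(`exists_small_frame`), a rescaled `ℚ`-basis `yᵢ` of `Y` whose multiplicative coordinates are
`log_p Vᵢⱼ` for algebraic principal units `Vᵢⱼ` so close to `1` that `exp(log_p Vᵢⱼ) = Vᵢⱼ` in
`ℂ_p` (`exists_nat_mul_eq_log`, `tendsto_norm_pow_prime_pow_sub_one`, `exists_delta_exp_log`;
Iwasawa's logarithm `padicLogAlgCl` is a homomorphism on `ℚ̄_pˣ`, which gives the logarithmic
relation `hrel` — the `p`-adic case has no periods), a finite spanning family of `ℚ̄`-points of `W`,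
and the number field generated by all these algebraic numbers with a common denominator
(`AlgSize.exists_den_house`).

## References

* [Roy1992] D. Roy, *Matrices whose coefficients are linear forms in logarithms*, J. Number
  Theory 41 (1992) 22–47: Notations (p. 24); §1 Theorem 1 (p. 25); §4 Theorem 4 (p. 34).
* [Waldschmidt1988] M. Waldschmidt, *On the transcendence methods of Gel'fond and Schneider in
  several variables*, New Advances in Transcendence Theory (A. Baker ed.), CUP 1988, 375–398:
  §4 Theorem 4.1 (pp. 382–383), §6 Proposition 6.1 (p. 389), §7 (p. 390).
* [LangCyclotomic1990] S. Lang, *Cyclotomic Fields I and II*, GTM 121, Ch. 4, Appendix to §3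
  (Iwasawa's logarithm) — via `PadicLogAlgCl(Proofs).lean`.
-/

noncomputable section

open Module Submodule Filter Topology
open Literature.NumberTheory.Transcendental.LinGroupK
open Literature.NumberTheory.Transcendental.RoyRank (LinTangent IsFLogSubspace IsFRational IsFPoint Thm1)
open Literature.NumberTheory.Transcendental.AlgSize (IsGood)

namespace Literature.NumberTheory.Transcendental

namespace RoyPadic

variable {p : ℕ} [Fact p.Prime]

/-! ### Elements of `L`: integer multiples are logarithms of algebraic principal units -/

/-- `‖1 - y^n‖ < 1` for a principal unit `y` and `n ∈ ℤ`. [folklore] -/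
private theorem norm_one_sub_zpow_lt {y : PadicAlgCl p} (hy : ‖1 - y‖ < 1) (n : ℤ) : ‖1 - y ^ n‖ < 1 := by
  rcases n with n | n
  · rw [Int.ofNat_eq_natCast, zpow_natCast]; exact IwasawaLog.norm_one_sub_pow_lt hy n
  · rw [zpow_negSucc]; exact IwasawaLog.norm_one_sub_inv_lt (IwasawaLog.norm_one_sub_pow_lt hy _)

/-- A principal unit is non-zero. [folklore] -/
private theorem ne_zero_of_norm_one_sub_lt {y : PadicAlgCl p} (hy : ‖1 - y‖ < 1) : y ≠ 0 := fun h => by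
  have h1 : ‖y‖ = 1 := IwasawaLog.norm_eq_one_of_norm_one_sub_lt hy
  rw [h, norm_zero] at h1; exact zero_ne_one h1

/-- Integer powers of algebraic elements are algebraic (cf. `KoblitzOgus.isAlgebraic_zpow`, not
imported here). [folklore] -/
private theorem isAlgebraic_zpow' {y : PadicAlgCl p} (hy : IsAlgebraic ℚ y) (n : ℤ) : IsAlgebraic ℚ (y ^ n) := by
  rcases n with n | n
  · rw [Int.ofNat_eq_natCast, zpow_natCast]; exact hy.pow n
  · rw [zpow_negSucc]; exact (hy.pow _).inv

variable (p) in
/-- **Every element of `L = ℚ · log_p(ℚ̄ ∩ U₁)` has a positive integer multiple which is the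
logarithm of an algebraic principal unit** (`log_p` is a homomorphism on `ℚ̄_pˣ`).
[cite: Roy1992, Notations (p. 24)] [cite: LangCyclotomic1990, Ch. 4, Appendix to §3] -/
theorem exists_nat_mul_eq_log {z : PadicAlgCl p} (hz : z ∈ logQSpan p) :
    ∃ N : ℕ, 0 < N ∧ ∃ u : PadicAlgCl p, IsAlgebraic ℚ u ∧ ‖1 - u‖ < 1 ∧
      (N : PadicAlgCl p) * z = padicLogAlgCl p u := by
  have hI := padicLogAlgCl_isIwasawaLog_holds p
  induction hz using Submodule.span_induction with
  | mem z hz =>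
    obtain ⟨u, hu, h1, rfl⟩ := hz
    exact ⟨1, Nat.one_pos, u, hu, h1, by simp⟩
  | zero => exact ⟨1, Nat.one_pos, 1, isAlgebraic_one, by simp, by simp [hI.log_one]⟩
  | add z z' _ _ ih ih' =>
    obtain ⟨N, hN, u, hu, hu1, hz⟩ := ih
    obtain ⟨N', hN', u', hu', hu1', hz'⟩ := ih'
    refine ⟨N * N', Nat.mul_pos hN hN', u ^ N' * u' ^ N, (hu.pow _).mul (hu'.pow _),
      IwasawaLog.norm_one_sub_mul_lt (IwasawaLog.norm_one_sub_pow_lt hu1 _)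
        (IwasawaLog.norm_one_sub_pow_lt hu1' _), ?_⟩
    have hu0 := ne_zero_of_norm_one_sub_lt hu1
    have hu0' := ne_zero_of_norm_one_sub_lt hu1'
    rw [hI.2.2.1 _ _ (pow_ne_zero _ hu0) (pow_ne_zero _ hu0'), hI.log_pow hu0, hI.log_pow hu0', ← hz,
      ← hz']
    push_cast
    ring
  | smul q z _ ih =>
    obtain ⟨N, hN, u, hu, hu1, hz⟩ := ih
    have hu0 := ne_zero_of_norm_one_sub_lt hu1
    rw [Rat.smul_def]
    refine ⟨N * q.den, Nat.mul_pos hN q.den_pos, u ^ q.num, isAlgebraic_zpow' hu _,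
      norm_one_sub_zpow_lt hu1 _, ?_⟩
    rw [hI.log_zpow hu0, ← hz]
    have hq : (q : PadicAlgCl p) * (q.den : PadicAlgCl p) = (q.num : PadicAlgCl p) := by
      have := Rat.mul_den_eq_num q
      exact_mod_cast this
    push_cast
    calc (N : PadicAlgCl p) * (q.den : PadicAlgCl p) * ((q : PadicAlgCl p) * z)
        = ((q : PadicAlgCl p) * q.den) * (N * z) := by ring
      _ = (q.num : PadicAlgCl p) * (N * z) := by rw [hq]

/-- `log_p` of a finite product of non-zero elements. [folklore] -/
theorem log_finset_prod {ι : Type*} (s : Finset ι) {f : ι → PadicAlgCl p} (hf : ∀ i ∈ s, f i ≠ 0) :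
    padicLogAlgCl p (∏ i ∈ s, f i) = ∑ i ∈ s, padicLogAlgCl p (f i) := by
  classical
  have hI := padicLogAlgCl_isIwasawaLog_holds p
  induction s using Finset.induction_on with
  | empty => simp [hI.log_one]
  | insert a s ha ih =>
    rw [Finset.prod_insert ha, Finset.sum_insert ha,
      hI.2.2.1 _ _ (hf a (by simp)) (Finset.prod_ne_zero_iff.2 fun i hi => hf i (by simp [hi])),
      ih fun i hi => hf i (by simp [hi])]

/-! ### `exp ∘ log_p = id` near `1`, inside `ℂ_p` -/

/-- `ℚ̄_p → ℂ_p` on `1 - V`. [folklore] -/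
private theorem coe_one_sub (V : PadicAlgCl p) : (((1 - V : PadicAlgCl p)) : ℂ_[p]) = 1 - (V : ℂ_[p]) := by
  change UniformSpace.Completion.coeRingHom (1 - V) = _
  rw [map_sub, map_one]; rfl

/-- `ℚ̄_p → ℂ_p` on powers. [folklore] -/
private theorem coe_pow' (V : PadicAlgCl p) (k : ℕ) : (((V ^ k : PadicAlgCl p)) : ℂ_[p]) = (V : ℂ_[p]) ^ k := by
  change UniformSpace.Completion.coeRingHom (V ^ k) = _
  rw [map_pow]; rfl

/-- `‖1 - V‖` is the same in `ℚ̄_p` and in `ℂ_p`. [folklore] -/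
theorem norm_one_sub_coe (V : PadicAlgCl p) : ‖(1 : ℂ_[p]) - (V : ℂ_[p])‖ = ‖1 - V‖ := by
  rw [← coe_one_sub, PadicComplex.norm_extends]

/-- The image in `ℂ_p` of `log_p` of a principal unit is the sum of the logarithmic series in `ℂ_p`.
[folklore] -/
theorem coe_log_eq_tsum {V : PadicAlgCl p} (hV : ‖1 - V‖ < 1) :
    ((padicLogAlgCl p V : PadicAlgCl p) : ℂ_[p]) =
      ∑' n : ℕ, -((1 - (V : ℂ_[p])) ^ (n + 1)) / (n + 1 : ℂ_[p]) := by
  rw [IwasawaLog.log_eq_padicLogSeriesAlgCl hV]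
  have hs := IwasawaLog.hasSum_padicLogSeriesAlgCl hV
  have hc : Continuous ((↑) : PadicAlgCl p → ℂ_[p]) := UniformSpace.Completion.continuous_coe _
  have hs' := hs.map (UniformSpace.Completion.coeRingHom : PadicAlgCl p →+* ℂ_[p]) hc
  have key : ((UniformSpace.Completion.coeRingHom : PadicAlgCl p →+* ℂ_[p]) ∘
      fun n : ℕ => -((1 - V) ^ (n + 1)) / (n + 1 : PadicAlgCl p)) =
      fun n : ℕ => -((1 - (V : ℂ_[p])) ^ (n + 1)) / (n + 1 : ℂ_[p]) := by
    funext n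
    simp only [Function.comp_apply, map_neg, map_div₀, map_pow, map_sub, map_one, map_add,
      map_natCast]
    rfl
  rw [key] at hs'
  exact hs'.tsum_eq.symm

variable (p) in
/-- **`exp(log_p V) = V` in `ℂ_p` for principal units `V` close enough to `1`** (local surjectivity
of `exp` at `1`, `PadicExp.exists_forall_exists_exp_eq`, and `log(exp c) = c`,
`BrumerPadic.logSeries_exp`). [folklore] -/
theorem exists_delta_exp_log :
    ∃ δ : ℝ, 0 < δ ∧ ∀ V : PadicAlgCl p, ‖1 - V‖ < δ →
      ((V : PadicAlgCl p) : ℂ_[p]) = NormedSpace.exp (((padicLogAlgCl p V : PadicAlgCl p) : ℂ_[p])) := by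
  have hp : p.Prime := Fact.out
  obtain ⟨δ₀, hδ₀, hδ⟩ := PadicExp.exists_forall_exists_exp_eq (ℓ := p) (E := ℂ_[p])
    (inv_pos.2 (by exact_mod_cast hp.pos : (0 : ℝ) < p))
  refine ⟨min δ₀ 1, lt_min hδ₀ zero_lt_one, fun V hV => ?_⟩
  have hV1 : ‖1 - V‖ < 1 := lt_of_lt_of_le hV (min_le_right _ _)
  have hw : ‖(V : ℂ_[p]) - 1‖ < δ₀ := by
    rw [norm_sub_rev, norm_one_sub_coe]
    exact lt_of_lt_of_le hV (min_le_left _ _)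
  obtain ⟨c, hc, hcV⟩ := hδ _ hw
  rw [coe_log_eq_tsum hV1, ← hcV, BrumerPadic.logSeries_exp hc]

/-- **`‖1 - u^{p^e}‖ → 0`** for a principal unit `u` (from the limit formula
`(u^{p^e} - 1)/p^e → log u` in `ℂ_p`). [folklore] -/
theorem tendsto_norm_one_sub_pow_prime_pow {u : PadicAlgCl p} (hu : ‖1 - u‖ < 1) :
    Tendsto (fun e : ℕ => ‖1 - u ^ (p ^ e)‖) atTop (𝓝 0) := by
  have hp : p.Prime := Fact.out
  set w : ℂ_[p] := (u : ℂ_[p]) with hw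
  have hw1 : ‖1 - w‖ < 1 := by rw [hw, norm_one_sub_coe]; exact hu
  have hT := IwasawaLog.tendsto_pow_prime_pow_sub_one_div (p := p) (F := ℂ_[p]) w hw1
  have hP : Tendsto (fun e : ℕ => ((p : ℂ_[p])) ^ e) atTop (𝓝 0) := by
    apply tendsto_pow_atTop_nhds_zero_of_norm_lt_one
    rw [PadicExp.norm_natCast_prime (ℓ := p)]
    exact inv_lt_one_of_one_lt₀ (by exact_mod_cast hp.one_lt)
  have hprod := hP.mul hT
  rw [zero_mul] at hprod
  have hp0 : ∀ e : ℕ, ((p : ℂ_[p])) ^ e ≠ 0 := fun e => pow_ne_zero _ (by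
    rw [← norm_pos_iff, PadicExp.norm_natCast_prime (ℓ := p)]
    exact inv_pos.2 (by exact_mod_cast hp.pos))
  have heq : ∀ e : ℕ, ((p : ℂ_[p])) ^ e * ((w ^ p ^ e - 1) / (p : ℂ_[p]) ^ e) = w ^ p ^ e - 1 := fun e => by
    rw [← mul_div_assoc, mul_div_cancel_left₀ _ (hp0 e)]
  have h2 : Tendsto (fun e : ℕ => w ^ p ^ e - 1) atTop (𝓝 0) := hprod.congr heq
  have h3 := (tendsto_zero_iff_norm_tendsto_zero.1 h2)
  refine h3.congr fun e => ?_
  rw [norm_sub_rev, hw, ← coe_pow', norm_one_sub_coe]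

/-! ### Powers of `p` make finitely many elements small -/

/-- For finitely many `z_a ∈ ℚ̄_p` and `r > 0`, eventually `‖p^e z_a‖ ≤ r`. [folklore] -/
theorem eventually_norm_prime_pow_mul_le {ι : Type*} [Finite ι] (z : ι → PadicAlgCl p) {r : ℝ} (hr : 0 < r) :
    ∀ᶠ e : ℕ in atTop, ∀ a, ‖((p : PadicAlgCl p)) ^ e * z a‖ ≤ r := by
  have hp : p.Prime := Fact.out
  haveI := Fintype.ofFinite ι
  refine Filter.eventually_all.2 fun a => ?_
  have hP : Tendsto (fun e : ℕ => ‖((p : PadicAlgCl p)) ^ e * z a‖) atTop (𝓝 0) := by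
    have h1 : Tendsto (fun e : ℕ => ((p : PadicAlgCl p)) ^ e) atTop (𝓝 0) := by
      apply tendsto_pow_atTop_nhds_zero_of_norm_lt_one
      rw [PadicExp.norm_natCast_prime (ℓ := p)]
      exact inv_lt_one_of_one_lt₀ (by exact_mod_cast hp.one_lt)
    have h2 := h1.mul_const (z a)
    rw [zero_mul] at h2
    exact tendsto_zero_iff_norm_tendsto_zero.1 h2
  exact (hP.eventually (Iic_mem_nhds hr)).mono fun e he => he

/-! ### A small frame for `V` -/

variable (p) in
/-- **A small frame of `V`.** Every subspace `V ⊆ K^{d₀} × K^{d₁}` (`K = ℚ̄_p`) of dimension `n` has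
a frame `Φ` on `K^n` with all coefficients of norm `≤ p⁻²` parametrising `V` — `Φ.vec c ∈ V` for all
`c`, and a `K`-linear coordinate map `cV : V → K^n` with `Φ.vec (cV x) = x` — whose coefficients lie
in a finite extension `M` of `ℚ_p` inside `K` (a basis of `V` scaled by a power of `p`; its
coordinates are algebraic over `ℚ_p`). [folklore] -/
theorem exists_small_frame {d₀ d₁ : ℕ} (V : Submodule (PadicAlgCl p) (LinTangent (PadicAlgCl p) d₀ d₁)) :
    ∃ (Φ : Frame (PadicAlgCl p) (finrank (PadicAlgCl p) V) d₀ d₁)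
      (cV : V →ₗ[PadicAlgCl p] (Fin (finrank (PadicAlgCl p) V) → PadicAlgCl p))
      (M : IntermediateField ℚ_[p] (PadicAlgCl p)),
      Φ.Small (((p : ℝ)⁻¹) ^ 2) ∧ (∀ c, Φ.vec c ∈ V) ∧ (∀ x : V, Φ.vec (cV x) = x) ∧
      FiniteDimensional ℚ_[p] M ∧ (∀ i k, Φ.A i k ∈ M) ∧ ∀ j k, Φ.B j k ∈ M := by
  classical
  have hp : p.Prime := Fact.out
  have hp0 : (0 : ℝ) < p := by exact_mod_cast hp.pos
  set n := finrank (PadicAlgCl p) V with hn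
  let bV := Module.finBasis (PadicAlgCl p) V
  let u : Fin n → LinTangent (PadicAlgCl p) d₀ d₁ := fun k => (bV k : LinTangent (PadicAlgCl p) d₀ d₁)
  -- a power of `p` making all coordinates of the basis small
  have hρ : (0 : ℝ) < ((p : ℝ)⁻¹) ^ 2 := by positivity
  obtain ⟨e, he⟩ := ((eventually_norm_prime_pow_mul_le (ι := Fin n × Fin d₀) (fun q => (u q.1).1 q.2) hρ).and
    (eventually_norm_prime_pow_mul_le (ι := Fin n × Fin d₁) (fun q => (u q.1).2 q.2) hρ)).exists
  set π : PadicAlgCl p := ((p : PadicAlgCl p)) ^ e with hπ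
  have hπ0 : π ≠ 0 := pow_ne_zero _ (by exact_mod_cast hp.ne_zero)
  let Φ : Frame (PadicAlgCl p) n d₀ d₁ := ⟨fun i k => π * (u k).1 i, fun j k => π * (u k).2 j⟩
  -- `Φ.vec c = ∑ (c_k π) • u_k`
  have hvec : ∀ c : Fin n → PadicAlgCl p, Φ.vec c = ∑ k, (c k * π) • u k := by
    intro c
    ext i
    · simp only [Frame.vec, Prod.fst_sum, Finset.sum_apply, Prod.smul_fst, Pi.smul_apply, smul_eq_mul, Φ]
      exact Finset.sum_congr rfl fun k _ => by ring
    · simp only [Frame.vec, Prod.snd_sum, Finset.sum_apply, Prod.smul_snd, Pi.smul_apply, smul_eq_mul, Φ]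
      exact Finset.sum_congr rfl fun k _ => by ring
  let cV : V →ₗ[PadicAlgCl p] (Fin n → PadicAlgCl p) :=
    (LinearMap.lsmul (PadicAlgCl p) (Fin n → PadicAlgCl p) π⁻¹) ∘ₗ (bV.equivFun : V →ₗ[PadicAlgCl p] _)
  let M : IntermediateField ℚ_[p] (PadicAlgCl p) :=
    IntermediateField.adjoin ℚ_[p] (Set.range (fun q : Fin d₀ × Fin n => Φ.A q.1 q.2) ∪
      Set.range (fun q : Fin d₁ × Fin n => Φ.B q.1 q.2))
  refine ⟨Φ, cV, M, ⟨fun i k => ?_, fun j k => ?_⟩, fun c => ?_, fun x => ?_, ?_, fun i k => ?_, fun j k => ?_⟩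
  · exact (he.1 (k, i))
  · exact (he.2 (k, j))
  · rw [hvec]
    exact V.sum_mem fun k _ => V.smul_mem _ (bV k).2
  · rw [hvec]
    have h1 : ∀ k, cV x k * π = bV.repr x k := by
      intro k
      change π⁻¹ • (bV.equivFun x) k * π = _
      rw [smul_eq_mul, Basis.equivFun_apply]
      field_simp
    simp_rw [h1]
    have := bV.sum_repr x
    conv_rhs => rw [← this]
    rw [Submodule.coe_sum]
    rfl
  · haveI : Finite ↥(Set.range (fun q : Fin d₀ × Fin n => Φ.A q.1 q.2) ∪
        Set.range (fun q : Fin d₁ × Fin n => Φ.B q.1 q.2)) :=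
      Set.Finite.to_subtype ((Set.finite_range _).union (Set.finite_range _))
    exact IntermediateField.finiteDimensional_adjoin fun x _ =>
      (Algebra.IsAlgebraic.isAlgebraic (R := ℚ_[p]) x).isIntegral
  · exact IntermediateField.subset_adjoin _ _ (Or.inl ⟨(i, k), rfl⟩)
  · exact IntermediateField.subset_adjoin _ _ (Or.inr ⟨(j, k), rfl⟩)


/-! ### Roy's Theorem 1 for `K = ℚ̄_p` -/

/-- Rescaling a family by a non-zero rational keeps linear independence and the span. [folklore] -/
private theorem linearIndependent_and_span_of_smul {K : Type*} [Field K] [CharZero K] {ι M : Type*}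
    [AddCommGroup M] [Module K M] [Module ℚ M] [IsScalarTower ℚ K M] (b : ι → M)
    (hb : LinearIndependent ℚ (fun i => b i)) {c : ℚ} (hc : c ≠ 0) :
    LinearIndependent ℚ (fun i => (c : K) • b i) ∧
      span ℚ (Set.range fun i => (c : K) • b i) = span ℚ (Set.range b) := by
  have hcs : ∀ i, (c : K) • b i = c • b i := fun i => by
    rw [← algebraMap_smul K c (b i), eq_ratCast]
  simp_rw [hcs]
  refine ⟨?_, le_antisymm (span_le.2 ?_) (span_le.2 ?_)⟩
  · have := hb.units_smul fun _ => Units.mk0 c hc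
    convert this using 1
    funext i
    change c • b i = (Units.mk0 c hc : ℚˣ) • b i
    rw [Units.smul_def, Units.val_mk0]
  · rintro _ ⟨i, rfl⟩
    exact smul_mem _ _ (subset_span ⟨i, rfl⟩)
  · rintro _ ⟨i, rfl⟩
    have : b i = c⁻¹ • (c • b i) := by rw [smul_smul, inv_mul_cancel₀ hc, one_smul]
    rw [this]
    exact smul_mem _ _ (subset_span ⟨i, rfl⟩)

variable (p) in
/-- **Roy's Theorem 1 for `K = ℚ̄_p`, `F = ℚ̄`, `L = ℚ·log_p(ℚ̄ ∩ U₁)`, `Ω = 0`, from the zero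
estimate** ([Roy1992, §1 Theorem 1] = [Waldschmidt1988, Thm 4.1] for `G_a^{d₀} × G_m^{d₁}` over
`ℂ_p`): reduction of Roy's data to the normal form of `LinGroupK.exists_auxiliary`, then the
field-generic end of Waldschmidt's proof. The zero estimate with multiplicities on
`𝔾ₐ^{d₀} × 𝔾ₘ^{d₁}` ([Philippon1986, Thm 2.1]; `LinGroupK.ZeroEstimate`) is the hypothesis.
[cite: Roy1992, §1 Theorem 1 (p. 25)] [cite: Waldschmidt1988, Thm 4.1, Prop. 6.1 and §7] -/
theorem thm1_of_zeroEstimate (hZE : ∀ d₀ d₁, ZeroEstimate (PadicAlgCl p) d₀ d₁) :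
    Thm1 (padicQbar p) (logQSpan p) (0 : PadicAlgCl p) := by
  classical
  refine RoyRank.thm1_zero_of_linearSubgroupTheorem_weak (K := PadicAlgCl p) (F := padicQbar p)
    (L := logQSpan p) fun d₀ d₁ Y W V hfin hlog hrat hYV hWV hV => ?_
  haveI := hfin
  have hp : p.Prime := Fact.out
  have hI := padicLogAlgCl_isIwasawaLog_holds p
  have hpK : ((p : PadicAlgCl p)) ≠ 0 := by exact_mod_cast hp.ne_zero
  /- (1) a small frame of `V` -/
  set n : ℕ := finrank (PadicAlgCl p) V with hn
  obtain ⟨Φ, cV, M, hΦ, -, hcV, hMfin, hAM, hBM⟩ := exists_small_frame p V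
  haveI := hMfin
  have hnlt : n < d₀ + d₁ := by
    refine lt_of_le_of_ne ?_ fun heq => hV ?_
    · have := Submodule.finrank_le V
      rwa [finrank_lie] at this
    · exact Submodule.eq_top_of_finrank_eq (by rw [finrank_lie]; exact heq)
  have hcVsmul : ∀ (c : PadicAlgCl p) (x : LinTangent (PadicAlgCl p) d₀ d₁) (hx : x ∈ V) (k : Fin n),
      cV ⟨c • x, V.smul_mem c hx⟩ k = c * cV ⟨x, hx⟩ k := by
    intro c x hx k
    have : (⟨c • x, V.smul_mem c hx⟩ : V) = c • ⟨x, hx⟩ := rfl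
    rw [this, map_smul, Pi.smul_apply, smul_eq_mul]
  /- (2) a `ℚ`-basis of `Y` -/
  set m : ℕ := finrank ℚ Y with hm
  let bY := Module.finBasis ℚ Y
  let b : Fin m → LinTangent (PadicAlgCl p) d₀ d₁ := fun i => (bY i : LinTangent (PadicAlgCl p) d₀ d₁)
  have hbY : ∀ i, b i ∈ Y := fun i => (bY i).2
  have hbV : ∀ i, b i ∈ V := fun i => hYV (hbY i)
  have hbli : LinearIndependent ℚ b := bY.linearIndependent.map' Y.subtype (Submodule.ker_subtype Y)
  have hbspan : span ℚ (Set.range b) = Y := by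
    have h2 : Set.range b = Y.subtype '' Set.range bY := by rw [← Set.range_comp]; rfl
    rw [h2, ← Submodule.map_span, bY.span_eq, Submodule.map_top, Submodule.range_subtype]
  /- (3) logarithms: `N₀ · (b i).2 j = log_p (U i j)` -/
  have hlog2 : ∀ i j, (b i).2 j ∈ logQSpan p := fun i j => (hlog (b i) (hbY i)).2 j
  choose N hNpos u hu hu1 hNu using fun i j => exists_nat_mul_eq_log p (hlog2 i j)
  set N₀ : ℕ := ∏ i, ∏ j, N i j with hN₀
  have hN₀pos : 0 < N₀ := Finset.prod_pos fun i _ => Finset.prod_pos fun j _ => hNpos i j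
  have hNdvd : ∀ i j, N i j ∣ N₀ := fun i j =>
    (Finset.dvd_prod_of_mem _ (Finset.mem_univ j)).trans (Finset.dvd_prod_of_mem _ (Finset.mem_univ i))
  let U : Fin m → Fin d₁ → PadicAlgCl p := fun i j => u i j ^ (N₀ / N i j)
  have hU1 : ∀ i j, ‖1 - U i j‖ < 1 := fun i j => IwasawaLog.norm_one_sub_pow_lt (hu1 i j) _
  have hUalg : ∀ i j, IsAlgebraic ℚ (U i j) := fun i j => (hu i j).pow _
  have hNU : ∀ i j, (N₀ : PadicAlgCl p) * (b i).2 j = padicLogAlgCl p (U i j) := by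
    intro i j
    obtain ⟨c, hc⟩ := hNdvd i j
    have hq : N₀ / N i j = c := by rw [hc, Nat.mul_div_cancel_left _ (hNpos i j)]
    change _ = padicLogAlgCl p (u i j ^ (N₀ / N i j))
    rw [hq, hI.log_pow (ne_zero_of_norm_one_sub_lt (hu1 i j)), ← hNu, hc]
    push_cast
    ring
  /- (4) `ℚ̄`-points spanning `W` -/
  obtain ⟨B, hBsub, hBspan, hBli⟩ :=
    exists_linearIndependent (PadicAlgCl p) {v : LinTangent (PadicAlgCl p) d₀ d₁ | v ∈ W ∧ IsFPoint (padicQbar p) v}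
  haveI : Finite B := hBli.finite
  letI : Fintype B := Fintype.ofFinite B
  set t : ℕ := Fintype.card B with ht
  let eB : B ≃ Fin t := Fintype.equivFin B
  let wF : Fin t → LinTangent (PadicAlgCl p) d₀ d₁ := fun l => ((eB.symm l : B) : LinTangent (PadicAlgCl p) d₀ d₁)
  have hwFmem : ∀ l, wF l ∈ W ∧ IsFPoint (padicQbar p) (wF l) := fun l => hBsub (eB.symm l).2
  have hwFV : ∀ l, wF l ∈ V := fun l => hWV (hwFmem l).1
  have hwFspan : span (PadicAlgCl p) (Set.range wF) = W := by
    have hr : Set.range wF = B := by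
      ext v
      constructor
      · rintro ⟨l, rfl⟩; exact (eB.symm l).2
      · intro hv; exact ⟨eB ⟨v, hv⟩, by simp [wF]⟩
    rw [hr, hBspan]
    exact hrat.symm
  /- (5) the exponent `e` -/
  obtain ⟨δ, hδ, hδV⟩ := exists_delta_exp_log p
  have ev1 : ∀ᶠ e : ℕ in atTop, ∀ q : Fin m × Fin d₁, ‖1 - U q.1 q.2 ^ (p ^ e)‖ < δ :=
    Filter.eventually_all.2 fun q =>
      (tendsto_norm_one_sub_pow_prime_pow (hU1 q.1 q.2)).eventually (Iio_mem_nhds hδ)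
  have ev2 : ∀ᶠ e : ℕ in atTop, ∀ q : Fin m × Fin n,
      ‖((p : PadicAlgCl p)) ^ e * ((N₀ : PadicAlgCl p) * cV ⟨b q.1, hbV q.1⟩ q.2)‖ ≤ 1 :=
    eventually_norm_prime_pow_mul_le _ one_pos
  have ev3 : ∀ᶠ e : ℕ in atTop, ∀ q : Fin t × Fin n,
      ‖((p : PadicAlgCl p)) ^ e * cV ⟨wF q.1, hwFV q.1⟩ q.2‖ ≤ 1 :=
    eventually_norm_prime_pow_mul_le _ one_pos
  obtain ⟨e, ⟨he1, he2⟩, he3⟩ := ((ev1.and ev2).and ev3).exists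
  set π : PadicAlgCl p := ((p : PadicAlgCl p)) ^ e with hπ
  have hπ0 : π ≠ 0 := pow_ne_zero _ hpK
  have hπF : π ∈ padicQbar p := pow_mem (natCast_mem (padicQbar p) p) e
  /- (6) the rescaled basis `y`, its coordinates `yt`, the units `V i j` -/
  let y : Fin m → LinTangent (PadicAlgCl p) d₀ d₁ := fun i => ((N₀ : PadicAlgCl p) * π) • b i
  have hyV : ∀ i, y i ∈ V := fun i => V.smul_mem _ (hbV i)
  let yt : Fin m → Fin n → PadicAlgCl p := fun i => cV ⟨y i, hyV i⟩
  have hΦyt : ∀ i, Φ.vec (yt i) = y i := fun i => hcV ⟨y i, hyV i⟩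
  have hyfun : (fun i => Φ.vec (yt i)) = y := funext hΦyt
  have hyt : ∀ i k, ‖yt i k‖ ≤ 1 := by
    intro i k
    have : yt i k = π * ((N₀ : PadicAlgCl p) * cV ⟨b i, hbV i⟩ k) := by
      change cV ⟨((N₀ : PadicAlgCl p) * π) • b i, _⟩ k = _
      rw [hcVsmul _ _ (hbV i)]
      ring
    rw [this]
    exact he2 (i, k)
  let Vv : Fin m → Fin d₁ → PadicAlgCl p := fun i j => U i j ^ (p ^ e)
  have hVδ : ∀ i j, ‖1 - Vv i j‖ < δ := fun i j => he1 (i, j)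
  have hV1 : ∀ i j, ‖1 - Vv i j‖ < 1 := fun i j => IwasawaLog.norm_one_sub_pow_lt (hU1 i j) _
  have hVne : ∀ i j, Vv i j ≠ 0 := fun i j => ne_zero_of_norm_one_sub_lt (hV1 i j)
  have hValg : ∀ i j, IsAlgebraic ℚ (Vv i j) := fun i j => (hUalg i j).pow _
  have hy2 : ∀ i j, (y i).2 j = padicLogAlgCl p (Vv i j) := by
    intro i j
    change ((N₀ : PadicAlgCl p) * π) * (b i).2 j = padicLogAlgCl p (U i j ^ (p ^ e))
    rw [hI.log_pow (ne_zero_of_norm_one_sub_lt (hU1 i j)), ← hNU, hπ]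
    push_cast
    ring
  have hy1F : ∀ i i₀, (y i).1 i₀ ∈ padicQbar p := by
    intro i i₀
    change ((N₀ : PadicAlgCl p) * π) * (b i).1 i₀ ∈ padicQbar p
    exact mul_mem (mul_mem (natCast_mem (padicQbar p) N₀) hπF) ((hlog (b i) (hbY i)).1 i₀)
  let α : Fin m → Fin d₁ → (PadicAlgCl p)ˣ := fun i j => Units.mk0 (Vv i j) (hVne i j)
  have hα : ∀ i j, ((α i j : PadicAlgCl p) : ℂ_[p]) = NormedSpace.exp (((Φ.vec (yt i)).2 j : ℂ_[p])) := by
    intro i j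
    rw [hΦyt, hy2]
    exact hδV _ (hVδ i j)
  /- (7) the logarithmic relations -/
  have hrel : ∀ (χ : Fin d₁ → ℤ) (k : Fin m → ℤ), (∏ j, (∏ i, α i j ^ k i) ^ χ j) = 1 →
      ∑ j, (χ j : PadicAlgCl p) * (∑ i, (k i : PadicAlgCl p) • (y i).2) j = 0 := by
    intro χ k hprod
    have h1 : padicLogAlgCl p (((∏ j, (∏ i, α i j ^ k i) ^ χ j : (PadicAlgCl p)ˣ)) : PadicAlgCl p) = 0 := by
      rw [hprod, Units.val_one, hI.log_one]
    rw [Units.coe_prod, log_finset_prod _ (fun j _ => Units.ne_zero _)] at h1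
    rw [← h1]
    refine Finset.sum_congr rfl fun j _ => ?_
    rw [Units.val_zpow_eq_zpow_val, hI.log_zpow (Units.ne_zero _), Units.coe_prod,
      log_finset_prod _ (fun i _ => Units.ne_zero _)]
    congr 1
    rw [Finset.sum_apply]
    refine Finset.sum_congr rfl fun i _ => ?_
    rw [Pi.smul_apply, smul_eq_mul, Units.val_zpow_eq_zpow_val, hI.log_zpow (Units.ne_zero _), hy2]
    rfl
  /- (8) the rescaled generators of `W` and their coordinates -/
  let w' : Fin t → LinTangent (PadicAlgCl p) d₀ d₁ := fun l => π • wF l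
  have hw'W : ∀ l, w' l ∈ W := fun l => W.smul_mem _ (hwFmem l).1
  have hw'V : ∀ l, w' l ∈ V := fun l => hWV (hw'W l)
  let wt : Fin t → Fin n → PadicAlgCl p := fun l => cV ⟨w' l, hw'V l⟩
  have hΦwt : ∀ l, Φ.vec (wt l) = w' l := fun l => hcV ⟨w' l, hw'V l⟩
  have hwt : ∀ l k, ‖wt l k‖ ≤ 1 := by
    intro l k
    have : wt l k = π * cV ⟨wF l, hwFV l⟩ k := by
      change cV ⟨π • wF l, _⟩ k = _
      rw [hcVsmul _ _ (hwFV l)]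
    rw [this]
    exact he3 (l, k)
  have hWspan : span (PadicAlgCl p) (Set.range fun l => Φ.vec (wt l)) = W := by
    simp_rw [hΦwt]
    rw [← hwFspan]
    refine le_antisymm (span_le.2 ?_) (span_le.2 ?_)
    · rintro _ ⟨l, rfl⟩
      exact smul_mem _ _ (subset_span ⟨l, rfl⟩)
    · rintro _ ⟨l, rfl⟩
      have : wF l = π⁻¹ • w' l := by
        change wF l = π⁻¹ • (π • wF l)
        rw [smul_smul, inv_mul_cancel₀ hπ0, one_smul]
      rw [this]
      exact smul_mem _ _ (subset_span ⟨l, rfl⟩)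
  have hw'F : ∀ l, (∀ i₀, (w' l).1 i₀ ∈ padicQbar p) ∧ ∀ j, (w' l).2 j ∈ padicQbar p := fun l =>
    ⟨fun i₀ => mul_mem hπF ((hwFmem l).2.1 i₀), fun j => mul_mem hπF ((hwFmem l).2.2 j)⟩
  /- (9) the number field `k₀` -/
  let G : Set (PadicAlgCl p) :=
    ((Set.range (fun q : Fin m × Fin d₀ => (y q.1).1 q.2) ∪ Set.range (fun q : Fin m × Fin d₁ => Vv q.1 q.2)) ∪
      Set.range (fun q : Fin t × Fin d₀ => (w' q.1).1 q.2)) ∪ Set.range (fun q : Fin t × Fin d₁ => (w' q.1).2 q.2)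
  have hGalg : ∀ x ∈ G, IsAlgebraic ℚ x := by
    rintro x (((⟨q, rfl⟩ | ⟨q, rfl⟩) | ⟨q, rfl⟩) | ⟨q, rfl⟩)
    · exact mem_algebraicClosure_iff.1 (hy1F q.1 q.2)
    · exact hValg q.1 q.2
    · exact mem_algebraicClosure_iff.1 ((hw'F q.1).1 q.2)
    · exact mem_algebraicClosure_iff.1 ((hw'F q.1).2 q.2)
  haveI : Finite G := Set.Finite.to_subtype
    ((((Set.finite_range _).union (Set.finite_range _)).union (Set.finite_range _)).union (Set.finite_range _))
  let k₀ : IntermediateField ℚ (PadicAlgCl p) := IntermediateField.adjoin ℚ G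
  haveI : FiniteDimensional ℚ k₀ :=
    IntermediateField.finiteDimensional_adjoin fun x hx => (hGalg x hx).isIntegral
  haveI : NumberField k₀ := NumberField.mk
  have hGk : ∀ x ∈ G, x ∈ k₀ := fun x hx => IntermediateField.subset_adjoin ℚ G hx
  let ek : k₀ →+* PadicAlgCl p := (algebraMap k₀ (PadicAlgCl p) : k₀ →+* PadicAlgCl p)
  have hek : ∀ x : k₀, ek x = (x : PadicAlgCl p) := fun x => rfl
  let y₀ : Fin m → Fin d₀ → k₀ := fun i i₀ => ⟨(y i).1 i₀, hGk _ (Or.inl (Or.inl (Or.inl ⟨(i, i₀), rfl⟩)))⟩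
  have hVk : ∀ i j, Vv i j ∈ k₀ := fun i j => hGk _ (Or.inl (Or.inl (Or.inr ⟨(i, j), rfl⟩)))
  let α₀ : Fin m → Fin d₁ → k₀ˣ := fun i j =>
    Units.mk0 ⟨Vv i j, hVk i j⟩ fun h => hVne i j (congrArg Subtype.val h)
  let w₀ : Fin t → (Fin d₀ → k₀) × (Fin d₁ → k₀) := fun l =>
    (fun i₀ => ⟨(w' l).1 i₀, hGk _ (Or.inl (Or.inr ⟨(l, i₀), rfl⟩))⟩,
      fun j => ⟨(w' l).2 j, hGk _ (Or.inr ⟨(l, j), rfl⟩)⟩)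
  have hy₀ : ∀ i i₀, ek (y₀ i i₀) = (Φ.vec (yt i)).1 i₀ := fun i i₀ => by rw [hΦyt]; rfl
  have hα₀ : ∀ i j, ek (α₀ i j : k₀) = (α i j : PadicAlgCl p) := fun i j => rfl
  have hw₀ : ∀ l, tmapHom ek (w₀ l) = Φ.vec (wt l) := fun l => by rw [hΦwt]; rfl
  /- (10) a common denominator and house -/
  let g : (Fin m × Fin d₀) ⊕ (Fin m × Fin d₁) ⊕ (Fin t × Fin d₀) ⊕ (Fin t × Fin d₁) → k₀ :=
    fun x => match x with
    | Sum.inl q => y₀ q.1 q.2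
    | Sum.inr (Sum.inl q) => (α₀ q.1 q.2 : k₀)
    | Sum.inr (Sum.inr (Sum.inl q)) => (w₀ q.1).1 q.2
    | Sum.inr (Sum.inr (Sum.inr q)) => (w₀ q.1).2 q.2
  obtain ⟨d, C, hd, hC, hg⟩ := AlgSize.exists_den_house g
  set Cg : ℝ := |(d : ℝ)| * C with hCg
  have hd1 : (1 : ℝ) ≤ |(d : ℝ)| := by exact_mod_cast Int.one_le_abs hd
  have hCg1 : 1 ≤ Cg := one_le_mul_of_one_le_of_one_le hd1 hC
  have hgy : ∀ i i₀, IsGood d 1 Cg (y₀ i i₀) := fun i i₀ => hg (Sum.inl (i, i₀))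
  have hgα : ∀ i j, IsGood d 1 Cg (α₀ i j : k₀) := fun i j => hg (Sum.inr (Sum.inl (i, j)))
  have hgw : ∀ l, (∀ i, IsGood d 1 Cg ((w₀ l).1 i)) ∧ ∀ j, IsGood d 1 Cg ((w₀ l).2 j) := fun l =>
    ⟨fun i => hg (Sum.inr (Sum.inr (Sum.inl (l, i)))), fun j => hg (Sum.inr (Sum.inr (Sum.inr (l, j))))⟩
  /- (11) the auxiliary functions -/
  have hAF := exists_auxiliary p hnlt Φ M ⟨hAM, hBM⟩ hΦ yt hyt α hα wt hwt ek y₀ hy₀ α₀ hα₀ w₀ hw₀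
    hd hCg1 hgy hgα hgw
  rw [hWspan, hyfun] at hAF
  /- (12) the basis `y` of `Y` and the end of the proof -/
  have hcq : ((N₀ * p ^ e : ℕ) : ℚ) ≠ 0 := by
    have : 0 < N₀ * p ^ e := Nat.mul_pos hN₀pos (pow_pos hp.pos e)
    exact_mod_cast this.ne'
  have hyc : y = fun i => (((N₀ * p ^ e : ℕ) : ℚ) : PadicAlgCl p) • b i := by
    funext i
    change ((N₀ : PadicAlgCl p) * π) • b i = _
    congr 1
    rw [hπ]; push_cast; ring
  obtain ⟨hyli, hyspan⟩ := linearIndependent_and_span_of_smul (K := PadicAlgCl p) b hbli hcq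
  rw [← hyc] at hyli hyspan
  rw [hbspan] at hyspan
  exact royObstruction_of_zeroEstimate_of_auxiliary hV y hyli hyspan α hrel (hZE d₀ d₁) hAF

variable (p) in
/-- **Roy's Theorem 1 for `ℚ̄_p` from the complex zero estimate** (Steinitz transport
`ℂ ≃+* ℚ̄_p` of the purely algebraic zero estimate, `LinGroupK.zeroEstimate_padicAlgCl_of_complex`).
[cite: Roy1992, §1 Theorem 1 (p. 25)] [cite: Waldschmidt1988, Thm 4.1] -/
theorem thm1_of_complexZeroEstimate (hZE : ∀ d₀ d₁, ZeroEstimate ℂ d₀ d₁) :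
    Thm1 (padicQbar p) (logQSpan p) (0 : PadicAlgCl p) :=
  thm1_of_zeroEstimate p fun d₀ d₁ => zeroEstimate_padicAlgCl_of_complex p (hZE d₀ d₁)

end RoyPadic

section Discharge

variable (p : ℕ) [Fact p.Prime]

/-- **Roy 1992, Theorem 4 for `K = ℚ̄_p` from the zero estimate on `𝔾ₐ^{d₀} × 𝔾ₘ^{d₁}`**: the named
fact `roy1992_padic_thm4` follows from Philippon's zero estimate with multiplicities over `ℂ`
(`LinGroupK.ZeroEstimate ℂ d₀ d₁` for all `d₀, d₁` — the hypothesis `hZE` of the tree's complex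
assembly `LinGroup.weakObstruction_of_zeroEstimate_of_auxiliary`), everything else being proved:
the `p`-adic transcendence argument (`RoyPadic.thm1_of_zeroEstimate`) and Roy's linear algebra
(`roy1992_padic_thm4_of_waldschmidt`). [cite: Roy1992, §4 Theorem 4 (p. 34) and §1 Theorem 1 (p. 25)]
[cite: Waldschmidt1988, Thm 4.1] -/
theorem roy1992_padic_thm4_of_complexZeroEstimate
    (hZE : ∀ d₀ d₁, LinGroupK.ZeroEstimate ℂ d₀ d₁) : roy1992_padic_thm4 p :=
  roy1992_padic_thm4_of_waldschmidt p (RoyPadic.thm1_of_complexZeroEstimate p hZE)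

/-- The same over `ℚ̄_p`: `roy1992_padic_thm4` from the zero estimate stated over `ℚ̄_p`.
[cite: Roy1992, §4 Theorem 4 (p. 34)] -/
theorem roy1992_padic_thm4_of_zeroEstimate
    (hZE : ∀ d₀ d₁, LinGroupK.ZeroEstimate (PadicAlgCl p) d₀ d₁) : roy1992_padic_thm4 p :=
  roy1992_padic_thm4_of_waldschmidt p (RoyPadic.thm1_of_zeroEstimate p hZE)

/-- **Roy's Theorem 1 for `ℚ̄_p` holds** (M. Waldschmidt's Theorem 4.1 for `G_a^{d₀} × G_m^{d₁}`
over `ℂ_p`, in Roy's notation with `F = ℚ̄`, `L = ℚ·log_p(ℚ̄ ∩ U₁)`, `Ω = 0`): the zero estimate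
is the tree's `LinGroup.zeroEstimate` ([Philippon1986, Thm 2.1], `LinGroupZEMain.lean`),
transported from `ℂ` to `ℚ̄_p`. [cite: Roy1992, §1 Theorem 1 (p. 25)] [cite: Waldschmidt1988, Thm 4.1]
[cite: Philippon1986, Thm 2.1] -/
theorem RoyPadic.thm1_holds : RoyRank.Thm1 (padicQbar p) (RoyPadic.logQSpan p) (0 : PadicAlgCl p) :=
  RoyPadic.thm1_of_zeroEstimate p fun d₀ d₁ =>
    LinGroupK.zeroEstimate_padicAlgCl_of_complex p
      (LinGroupK.zeroEstimate_complex_iff.2 (LinGroup.zeroEstimate d₀ d₁))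

/-- **Discharge of the named fact `roy1992_padic_thm4` (Roy 1992, §4 Theorem 4 for `K = ℚ̄_p`).**
Roy's Theorem 4 over `K = ℂ_p` restricted to `ℚ̄_p` — for `Z ⊆ 𝓛̃^d` of finite dimension over `ℚ̄`
contained in a `K`-subspace `U` of `K^d` and a non-zero minimal rational surjection
`t : K^d → K^{d'}`, `dim_ℚ̄ Z / dim_K t(U) ≤ d / d'`, with the strictness clause — PROVED:
Roy's linear algebra (`roy1992_padic_thm4_of_waldschmidt`: Theorem 4 ⇐ Theorem 2 ⇐ Theorem 1,
`RoyRankGeneric*.lean`, `RoyPadicRankThm4*.lean`) and Roy's Theorem 1 for `ℚ̄_p`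
(`RoyPadic.thm1_holds`: the `p`-adic six-step transcendence proof of [Waldschmidt1988] with
Philippon's zero estimate). [cite: Roy1992, §4 Theorem 4 (p. 34); §1 Theorem 1 (p. 25); Notations (p. 24)]
[cite: Waldschmidt1988, Thm 4.1, Prop. 6.1, §7] [cite: Philippon1986, Thm 2.1] -/
theorem roy1992_padic_thm4_holds : roy1992_padic_thm4 p :=
  roy1992_padic_thm4_of_waldschmidt p (RoyPadic.thm1_holds p)

end Discharge

end Literature.NumberTheory.Transcendental
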